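import Summits.CriticalPhenomena.PercolationContinuityZ3.Theorems.PercNearOneGluingNoHeavyLowerTailAntitheticEarCycle
import Summits.CriticalPhenomena.PercolationContinuityZ3.Theorems.PercNearOneGluingNoHeavyLowerTailAntitheticHandleOplus
import HarnessLib

/-!
# `NoHeavyLowerTail` (stmt-CriticalPhenomena-4575) — antithetic cluster pairs: **THEOREM Θ²** — the vertex antithetic inequality at
# `R = {x}` (CONJECTURE Δ2) for a θ-GRAPH PLUS A HANDLE, and ⊕-POSITIVITY OF θ-GRAPHS (HOME/MEMO-gen63.md §3–§4; prim-hp-2 gen 63)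

Support file (`--supports stmt-CriticalPhenomena-4575`, hull-port prover `prim-hp-2`, gen 63).  No definitions, no named facts, no sorries;
standard axioms.  VERTEX version (HOME/THEOREM-Theta.md): `X/Y` = red/blue vertex clusters of the source; the vertex antithetic inequality at
`R = {x}` is `0 ≤ Σ_{ω : ¬(x ∈ X_E ω ∧ x ∈ Y_E ω)} (F(X_E ω) − F(Y_E ω))(G(X_E ω) − G(Y_E ω))` for monotone `F, G` — CONJECTURE Δ2 at the
degree-2 vertex `x`.

THE θ-GRAPH `K`: a cycle `v 0 = s, …, v (n-1), v n = v 0` (`n ≥ 3`) and an ear `r 0 = v α, r 1, …, r ℓ = v β` (`α < β < n`, `ℓ ≥ 1`,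
interior vertices fresh; no ear pair is a cycle pair — automatic for `ℓ ≥ 2`, for a chord it says the poles are not adjacent on the cycle);
edge set `E₀ = Cyc.edgeSet n v ∪ Cyc.edgeSet ℓ r`.  `P = v p` (`0 < p < n`) a cycle vertex with NOT (`α = 0 ∧ p = β`), i.e. `s` and `P` are
not the two poles.  (Every θ-graph with marked `s`, `P` not both poles can be so presented: take the cycle through the paths of `s` and `P`.)
* `Antithetic.Cyc.theta_oplus_nonneg` — **θ-GRAPHS ARE ⊕-POSITIVE**: `Σ_{T : P ∈ X_{E₀} T} K₁K₂(X T, Y T) ≥ 0` for all super-odd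
  twisted-monotone `K₁, K₂` (`Cyc.ear_boxes` + `Antithetic.Box.boxes_sum_nonneg`).
* `Antithetic.Cyc.theta_handle_vertex_sum_nonneg` — **THEOREM Θ²**: for `K` as above, ANY vertex `Q`, arms `y_0 = P, y_1, …, y_a = y` and
  `z_0 = Q, …, z_b = z` of fresh vertices (`a, b ≥ 0`), `x` fresh joined to `y, z`, `yz` not a pair of `H = K ∪ arms`: the vertex antithetic
  inequality at `R = {x}` holds for `E = H + xy + xz` (`Cyc.ear_boxes` + the ⊕-HANDLE THEOREM `Pendant.handle_vertex_sum_nonneg_of_boxes`).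
  With THEOREM Θ (cycle + handle, gen 62) this covers every "θ-graph + handle" except the handle from the pole opposite to `s` back to
  itself when `s` is a pole; pendant trees hang on by `Antithetic.Box.dom_insert_leaf` (not restated here).
[cite: VandenbergHaggstromKahn2005, §1 p. 6 ("Harris' inequality"), §1 p. 3 (open cluster `C_s`)]
-/

noncomputable section

namespace Summit.CriticalPhenomena.PercolationContinuityZ3.Theorems

open Literature.Probability.Percolation
open scoped Classical

namespace Antithetic

namespace Cyc

variable {V : Type*} [Fintype V] {n : ℕ} {v : ℕ → V} {ℓ : ℕ} {r : ℕ → V} {α β p : ℕ}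
  (hn : 3 ≤ n) (hinj : ∀ i j, i < n → j < n → v i = v j → i = j) (hper : v n = v 0) (hℓ : 1 ≤ ℓ)
  (hαβ : α < β) (hβn : β < n) (hp0 : 0 < p) (hpn : p < n) (hexc : ¬ (α = 0 ∧ p = β)) (hr0 : r 0 = v α) (hrℓ : r ℓ = v β)
  (hrfresh : ∀ j, 0 < j → j < ℓ → ∀ i, i ≤ n → r j ≠ v i) (hrinj : ∀ i j, i ≤ ℓ → j ≤ ℓ → r i = r j → i = j)
  (hRC : ∀ m, m < ℓ → ∀ i, i < n → edge r m ≠ edge v i)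
include hn hinj hper hℓ hαβ hβn hp0 hpn hexc hr0 hrℓ hrfresh hrinj hRC

/-- **θ-graphs are ⊕-positive.**  With `K` the θ-graph `Cyc.edgeSet n v ∪ Cyc.edgeSet ℓ r` and `P = v p` as in the module docstring
(`s`, `P` not both poles): `0 ≤ Σ_{T : P ∈ X T} K₁(X T, Y T)·K₂(X T, Y T)` for all super-odd twisted-monotone `K₁, K₂`. [this work] -/
theorem theta_oplus_nonneg (K₁ K₂ : Set V → Set V → ℝ)
    (hK₁ : ∀ ⦃A A' B B' : Set V⦄, A ⊆ A' → B' ⊆ B → K₁ A B ≤ K₁ A' B') (hso₁ : ∀ A B, 0 ≤ K₁ A B + K₁ B A)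
    (hK₂ : ∀ ⦃A A' B B' : Set V⦄, A ⊆ A' → B' ⊆ B → K₂ A B ≤ K₂ A' B') (hso₂ : ∀ A B, 0 ≤ K₂ A B + K₂ B A) :
    0 ≤ ∑ T ∈ Finset.univ.filter (fun T : Set (Sym2 V) => v p ∈ openCluster (T ∩ (edgeSet n v ∪ edgeSet ℓ r)) (v 0)),
      K₁ (openCluster (T ∩ (edgeSet n v ∪ edgeSet ℓ r)) (v 0)) (openCluster (Tᶜ ∩ (edgeSet n v ∪ edgeSet ℓ r)) (v 0)) *
        K₂ (openCluster (T ∩ (edgeSet n v ∪ edgeSet ℓ r)) (v 0)) (openCluster (Tᶜ ∩ (edgeSet n v ∪ edgeSet ℓ r)) (v 0)) := by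
  obtain ⟨C, Fix, N, -, hcover, hinside, huniq, hdom⟩ :=
    ear_boxes hn hinj hper hℓ hαβ hβn hp0 hpn hexc hr0 hrℓ hrfresh hrinj hRC
  refine Box.boxes_sum_nonneg _ _ _ Fix N (fun T hT => hcover T (Finset.mem_filter.1 hT).2)
    (fun c T hT => Finset.mem_filter.2 ⟨Finset.mem_univ _, hinside c T hT⟩) huniq hdom hK₁ hso₁ hK₂ hso₂

variable {ya za : ℕ → V} {a b : ℕ} {Q : V} (hy0 : ya 0 = v p) (hz0 : za 0 = Q)
  (hzfresh : ∀ i, 0 < i → i ≤ b → ∀ f ∈ edgeSet n v ∪ edgeSet ℓ r, za i ∈ f → f.IsDiag)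
  (hzinj : ∀ i j, i ≤ b → j ≤ b → za i = za j → i = j)
  (hsz : ∀ i, 0 < i → i ≤ b → v 0 ≠ za i) (hPz : ∀ i, 0 < i → i ≤ b → v p ≠ za i)
  (hyfresh : ∀ i, 0 < i → i ≤ a → ∀ f ∈ (edgeSet n v ∪ edgeSet ℓ r) ∪ edgeSet b za, ya i ∈ f → f.IsDiag)
  (hyinj : ∀ i j, i ≤ a → j ≤ a → ya i = ya j → i = j)
  (hsy : ∀ i, 0 < i → i ≤ a → v 0 ≠ ya i) (hzy : ∀ i, 0 < i → i ≤ a → za b ≠ ya i)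
include hy0 hz0 hzfresh hzinj hsz hPz hyfresh hyinj hsy hzy

/-- **THEOREM Θ² (θ-graph + handle).**  `K` the θ-graph `E₀ = Cyc.edgeSet n v ∪ Cyc.edgeSet ℓ r` (cycle through `s = v 0`, ear from
`v α` to `v β`), `P = v p` a cycle vertex with `s`, `P` not both poles, `Q` any vertex; arms `ya 0 = P, …, ya a = y` and `za 0 = Q, …,
za b = z` of fresh vertices, `x` fresh, `yz ∉ H = K ∪ arms`, `E = H + xz + xy`.  Then for all monotone `F, G`:
`0 ≤ Σ_{ω : ¬(x ∈ X_E ω ∧ x ∈ Y_E ω)} (F(X_E ω) − F(Y_E ω))·(G(X_E ω) − G(Y_E ω))`. [this work] -/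
theorem theta_handle_vertex_sum_nonneg {x : V}
    (hx : ∀ f ∈ (edgeSet b za ∪ (edgeSet n v ∪ edgeSet ℓ r)) ∪ edgeSet a ya, x ∈ f → f.IsDiag)
    (hxs : x ≠ v 0) (hxy : x ≠ ya a) (hxz : x ≠ za b) (hyz : ya a ≠ za b)
    (hg : s(ya a, za b) ∉ (edgeSet b za ∪ (edgeSet n v ∪ edgeSet ℓ r)) ∪ edgeSet a ya)
    {F G : Set V → ℝ} (hF : Monotone F) (hG : Monotone G) :
    0 ≤ ∑ ω ∈ Finset.univ.filter (fun ω : Set (Sym2 V) =>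
        ¬ ((openGraph (ω ∩ insert s(x, ya a) (insert s(x, za b)
              ((edgeSet b za ∪ (edgeSet n v ∪ edgeSet ℓ r)) ∪ edgeSet a ya)))).Reachable (v 0) x ∧
          (openGraph (ωᶜ ∩ insert s(x, ya a) (insert s(x, za b)
              ((edgeSet b za ∪ (edgeSet n v ∪ edgeSet ℓ r)) ∪ edgeSet a ya)))).Reachable (v 0) x)),
      (F (openCluster (ω ∩ insert s(x, ya a) (insert s(x, za b)
            ((edgeSet b za ∪ (edgeSet n v ∪ edgeSet ℓ r)) ∪ edgeSet a ya))) (v 0)) -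
          F (openCluster (ωᶜ ∩ insert s(x, ya a) (insert s(x, za b)
            ((edgeSet b za ∪ (edgeSet n v ∪ edgeSet ℓ r)) ∪ edgeSet a ya))) (v 0))) *
        (G (openCluster (ω ∩ insert s(x, ya a) (insert s(x, za b)
            ((edgeSet b za ∪ (edgeSet n v ∪ edgeSet ℓ r)) ∪ edgeSet a ya))) (v 0)) -
          G (openCluster (ωᶜ ∩ insert s(x, ya a) (insert s(x, za b)
            ((edgeSet b za ∪ (edgeSet n v ∪ edgeSet ℓ r)) ∪ edgeSet a ya))) (v 0))) := by
  obtain ⟨C, Fix, N, hFixE, hcover, hinside, huniq, hdom⟩ :=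
    ear_boxes hn hinj hper hℓ hαβ hβn hp0 hpn hexc hr0 hrℓ hrfresh hrinj hRC
  -- the θ-graph is loop-free
  have hnd : ∀ f ∈ edgeSet n v ∪ edgeSet ℓ r, ¬ f.IsDiag := by
    rintro f (⟨i, hi, rfl⟩ | ⟨j, hj, rfl⟩)
    · rw [edge, Sym2.mk_isDiag_iff]; exact v_ne_succ hn hinj hper hi
    · rw [edge, Sym2.mk_isDiag_iff]
      intro h
      exact absurd (hrinj j (j + 1) hj.le hj h) (by omega)
  exact Pendant.handle_vertex_sum_nonneg_of_boxes hzfresh hzinj hsz hPz Fix N hFixE hcover hinside huniq hdom hy0 hz0 hyfresh hyinj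
    hsy hzy hnd hx hxs hxy hxz hyz hg hF hG

end Cyc

end Antithetic

end Summit.CriticalPhenomena.PercolationContinuityZ3.Theorems
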